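import Summits.BirchSwinnertonDyer.BirchSwinnertonDyer.Theses.PrintX9
import Summits.BirchSwinnertonDyer.BirchSwinnertonDyer.Theorems.PrintX9HowardContainmentLightFrameOfPrintDepthPosLocalized
import Summits.BirchSwinnertonDyer.BirchSwinnertonDyer.Theorems.PrintX9HowardContainmentOfPrintStubRescaling
import Summits.BirchSwinnertonDyer.BirchSwinnertonDyer.Theorems.PrintX9HowardContainmentLightFramePinnedOfPrintSharpOfMuPart
import Literature.NumberTheory.EllipticCurves.HeegnerEnvelopeCoherentPairProofs
import Literature.NumberTheory.EllipticCurves.HeegnerGeomCoherentDataOfFrameProofs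
import Literature.NumberTheory.EllipticCurves.HeegnerCharIdealEnvelopePowTransferProofs
import Literature.NumberTheory.EllipticCurves.AnticyclotomicTowerSharpProofs
import HarnessLib

/-!
# The UNTIED light Howard containment `HowardContainmentLightFrame` (stmt-BirchSwinnertonDyer-24424) and its
# by-name entry `HowardContainmentLightFrameOfPrint` (stmt-BirchSwinnertonDyer-25235) FROM THE ROUTE'S OWN PRINT
# LEAVES — with the ONE binder the rev-18 typing of 25235 lacks: CGLS 2022 Thm. 4.1.1 (`CGLSHeegnerClassNonvanishing`)

Cell `pub/bsd-print-x9`, seat `bsd-line-x9-p1` (LEAD g5), write-crux stmt-BirchSwinnertonDyer-25235 (aside r203, banked at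
rev 20 under FINDING PIN-1 / ruling R0). CENSUS OF THE ITEM AS FILED. `HowardContainmentLightFrameOfPrint :=
MastellaZermanHowardDivisibility → CGLSHowardDivisibilityLocalized → AnticyclotomicTowerInRingClassFields →
HowardContainmentLightFrame` is NOT closable by name from its three binders: at `p ∣ h_K` the conclusion
`heegnerCharIdeal D F ^ 2 ≤ char_Λ(X_tors)` needs ONE Heegner family `F` whose quotient `𝔖 ⧸ ℋ_∞(F)` is `Λ`-torsion
(off the torsion locus `Module.charIdeal` is the junk value `⊤`, and `⊤ ≤ char_Λ(X_tors)` has no source), i.e. a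
non-torsion `Λ`-adic Heegner class — Cornut–Vatsal, entering print through CGLS 2022 Thm. 4.1.1 (`κ₁^{Hg} ≠ 0`). This is
the referee's REF-117 finding for the PINNED twin 26359, repaired there by the new item 27077 with the binders `hNV`
(`CGLSHeegnerClassNonvanishing`, 27103) and `hTw♯` (`AnticyclotomicTowerSharp`, 27076); the untied aside 25235 was never
re-typed. THIS FILE proves the correspondingly REPAIRED statements, sorry-free, from tree theorems only:

* `howardContainmentLightFrame_of_nonvanishing_of_towerSharp_of_cgls :
    CGLSHeegnerClassNonvanishing → AnticyclotomicTowerSharp → CGLSHowardDivisibilityLocalized → HowardContainmentLightFrame`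
  (A_light = 24424 from three print leaves of the route, all of them binders of `PrintX9.closes`);
* `howardContainmentLightFrame_of_nonvanishing_of_cgs_of_towerSharp :
    CGLSHeegnerClassNonvanishing → CGSHowardDivisibilityPLocalized → AnticyclotomicTowerSharp → HowardContainmentLightFrame`
  (the same with the CGS 2025 Thm. 6.5.2 binder `hCGS` (27112) of the live `closes` in place of CGLS 4.1.3);
* `howardContainmentLightFrameOfPrint_of_nonvanishing_of_towerSharp :
    CGLSHeegnerClassNonvanishing → AnticyclotomicTowerSharp → HowardContainmentLightFrameOfPrint`
  (25235 with its missing binder; `hMZ` and the unsharp `hTw` are not used);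
* §4, the sharp tower DISCHARGED by the landed theorem `Literature.NumberTheory.EllipticCurves.anticyclotomicTowerSharp`
  (x10b-p1-w2, p681041; Perrin-Riou 1987 §3.2 at any class number, from the tree's class field theory):
  `howardContainmentLightFrame_of_nonvanishing_of_cgls : CGLSHeegnerClassNonvanishing → CGLSHowardDivisibilityLocalized → HowardContainmentLightFrame`,
  `howardContainmentLightFrame_of_nonvanishing_of_cgs : CGLSHeegnerClassNonvanishing → CGSHowardDivisibilityPLocalized → HowardContainmentLightFrame`,
  and the MINIMAL repaired signature of the item
  **`howardContainmentLightFrameOfPrint_of_nonvanishing : CGLSHeegnerClassNonvanishing → HowardContainmentLightFrameOfPrint`**.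

PROOF (the SCALING REDUCTION of x9-p2's line `torsion-depth-light-ofprint` v3, every stub now a tree theorem): on a
rank-one light X9 frame, `jbar := IsAlgClosed.lift` along `ιC`, `𝔖 = D.S` and `X` by the existence theorems; the COHERENT
PAIR `(C, F₀)` on `(Dt, H.β)` with the module-level envelope `ℋ_∞(F₀) ≤ Λκ_∞(C)`, `g • Λκ_∞(C) ≤ ℋ_∞(F₀)` (`g ≠ 0`)
(`exists_coherent_pair_envelope`, x9-p2; needs `K_k ⊆ K[p^{k+1}]` = `hTw♯` and `[K[p] : K[1]] = p − 1` from the frame);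
`𝔖 ⧸ Λκ_∞(C)` torsion by `hNV` (CGLS Thm. 4.1.1), hence `𝔖 ⧸ ℋ_∞(F₀)` torsion (reverse envelope); `𝔖` f.g. of `Λ`-rank
one and `(p^m) · I(Λκ_∞(C))² ≤ char_Λ(X_tors)` at Selmer corank one by CGLS Thm. 4.1.3 (`hCGLS`; hypotheses by
`X9.thm413Hypotheses_of_lightFrame`, corank by `X9.selmerCorank_eq_one_of_rank_one`); `(p^n) · I(ℋ_∞(F₀)) ≤ I(Λκ_∞(C))`
(forward envelope); so `(p^{m+2n}) · I(ℋ_∞(F₀))² ≤ char_Λ(X_tors)`; and the landed μ-BLIND PROMOTION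
`PrintX9Rescaling.stub_rescaling` (p611262-lineage: answer with the RESCALED family `p^{m+2n} • F₀`) gives the untied `∃ F`.
NO μ-invariant statement, NO Howard port, NO Mastella–Zerman input is used.

HONEST FRAMING. (i) Kernel-valid AS TYPED and CONDITIONAL on the named leaves `hNV`/`hTw♯`/`hCGLS` (resp. `hCGS`) exactly
as every other row-9 closure is conditional on the ten print leaves; (ii) per PIN-1 / R0 the untied `∃ F` does not pin the
parametrisation, so these theorems are the kernel witness that 24424/25235 are μ-BLIND — they are NOT route currency and
change no `closes`; (iii) the item 25235 AS FILED stays open: its honest repair is the last signature above (verdict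
«misstated: binder `CGLSHeegnerClassNonvanishing` missing», the REF-117 class). «beyond-print
theorem»: no. No summit statement is proved; BSD is NOT proved by any of this.

References: [CastellaGrossiLeeSkinner2022] Thm. 4.1.1, Thm. 4.1.3 + Cor. 3.4.2, Rem. 4.1.4 (arXiv:2008.02571v2);
[CastellaGrossiSkinner2025] Thm. 6.5.2; [Howard2004HeegnerKolyvagin] §1, §3.3, Thm. B; [PerrinRiou1987BSMF] §1 p. 405,
§3.3–3.4; [Cornut2002] (Mazur's conjecture).
-/

set_option linter.dupNamespace false
set_option autoImplicit false

noncomputable section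

open scoped Classical Pointwise
open Literature Literature.NumberTheory.EllipticCurves WeierstrassCurve
  Literature.NumberTheory.EllipticCurves.ModularForms
  Literature.NumberTheory.EllipticCurves.CastellaGrossiLeeSkinner2022
open Summit.BirchSwinnertonDyer.BirchSwinnertonDyer.Theses.PrintX9

namespace Summit.BirchSwinnertonDyer.BirchSwinnertonDyer.Theorems.PrintX9OfPrintNonvanishing

/-! ## §1 The localized package on a light frame from `hNV` and CGLS Thm. 4.1.3, for the coherent pair -/

/-- Ideal bookkeeping: `(a) · ((b) · I)² = (a·b²) · I²`. [folklore] -/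
private theorem span_singleton_mul_sq {R : Type*} [CommSemiring R] (a b : R) (I : Ideal R) :
    Ideal.span {a} * (Ideal.span {b} * I) ^ 2 = Ideal.span {a * b ^ 2} * I ^ 2 := by
  rw [mul_pow, Ideal.span_singleton_pow, ← mul_assoc, Ideal.span_singleton_mul_span_singleton]

/-- **The localized package from the module-level envelope, CGLS Thm. 4.1.1 (torsion of `𝔖/Λκ_∞(C)`) and CGLS
Thm. 4.1.3 at Selmer corank one (the "Moreover" clause = Cor. 3.4.2) BY NAME**: `𝔖` finitely generated of
`Λ`-rank one, `𝔖/ℋ_∞(F)` torsion and `(p^m) · I(ℋ_∞(F))² ⊆ char_Λ(X_tors)` for some `m` — the four premisses of the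
landed promotion `PrintX9Rescaling.stub_rescaling`. [cite: CastellaGrossiLeeSkinner2022, Thm. 4.1.1, Thm. 4.1.3 ("Moreover") with Cor. 3.4.2, Rem. 4.1.4] -/
theorem package_of_envelopeModules_of_thm413
    {W : WeierstrassCurve ℚ} [W.IsGloballyMinimal] {p : ℕ} [Fact p.Prime] [NeZero (W.conductorNorm ℤ)]
    {K : Type} [Field K] [NumberField K] {κ : ZpExtension K p} {γ : Field.absoluteGaloisGroup K}
    {jbar : AlgebraicClosure K →+* ℂ}
    (h411 : thm411_torsionFree_heegnerClass_ne_bot_quotient_isTorsion.{0})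
    (h413 : thm413_rankOne_charIdeal_torsion_dvd_localized.{0})
    (hyp : Thm413Hypotheses (W.conductorNorm ℤ) W K p κ γ) (hrk : (W.baseChange K).selmerCorank p = 1)
    (D : (W.baseChange K).LambdaAdicSelmerData κ γ) (C : StabilizedHeegnerData (W.conductorNorm ℤ) W K κ jbar)
    (F : HeegnerFamily (W.conductorNorm ℤ) W K κ jbar) (X : (W.baseChange K).SelmerDualData κ γ)
    {e : ℕ} {g : IwasawaAlgebra p} (hg : g ≠ 0)
    (hfwd : ((p : IwasawaAlgebra p) ^ e) • heegnerModule D F ≤ stabilizedHeegnerModule D C)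
    (hrev : g • stabilizedHeegnerModule D C ≤ heegnerModule D F) :
    Module.Finite (IwasawaAlgebra p) D.S ∧ Module.finrank (IwasawaAlgebra p) D.S = 1 ∧
      Module.IsTorsion (IwasawaAlgebra p) (D.S ⧸ heegnerModule D F) ∧
      ∃ m : ℕ, Ideal.span {((p : IwasawaAlgebra p) ^ m)} * heegnerCharIdeal D F ^ 2 ≤
        Module.charIdeal (IwasawaAlgebra p) (Submodule.torsion (IwasawaAlgebra p) X.X) := by
  obtain ⟨⟨hSfin, hS1⟩, -⟩ := h413 (W.conductorNorm ℤ) W K p κ γ jbar hyp D C X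
  haveI := hSfin
  have htorC : Module.IsTorsion (IwasawaAlgebra p) (D.S ⧸ stabilizedHeegnerModule D C) :=
    isTorsion_quotient_stabilizedHeegnerModule_of_thm411 h411 hyp D C
  have htorF : Module.IsTorsion (IwasawaAlgebra p) (D.S ⧸ heegnerModule D F) :=
    isTorsion_quotient_heegnerModule_of_smul_stabilizedHeegnerModule_le D F C hg hrev htorC
  obtain ⟨n, henv⟩ :=
    exists_span_pow_mul_heegnerCharIdeal_le_stabilizedHeegnerCharIdeal_of_pow_smul_le D F C e hfwd htorF
  obtain ⟨m, hm⟩ := span_pow_mul_sq_le_charIdeal_torsion_of_thm413 h413 hyp hrk D C X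
  refine ⟨hSfin, hS1, htorF, m + n * 2, ?_⟩
  calc Ideal.span {((p : IwasawaAlgebra p) ^ (m + n * 2))} * heegnerCharIdeal D F ^ 2
      = Ideal.span {((p : IwasawaAlgebra p) ^ m)} *
          (Ideal.span {((p : IwasawaAlgebra p) ^ n)} * heegnerCharIdeal D F) ^ 2 := by
        rw [span_singleton_mul_sq, ← pow_mul, ← pow_add]
    _ ≤ Ideal.span {((p : IwasawaAlgebra p) ^ m)} * stabilizedHeegnerCharIdeal D C ^ 2 :=
        Ideal.mul_mono_right (Ideal.pow_right_mono henv 2)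
    _ ≤ _ := hm

/-! ## §2 The untied light containment from `hNV`, `hTw♯` and CGLS Thm. 4.1.3 -/

/-- **`HowardContainmentLightFrame` (stmt-BirchSwinnertonDyer-24424, the UNTIED light Howard containment) from three
print leaves of the route BY NAME** — CGLS 2022 Thm. 4.1.1 (`CGLSHeegnerClassNonvanishing`: `𝔖/Λκ_∞(C)` torsion,
Cornut–Vatsal), the sharp tower `K_k ⊆ K[p^{k+1}]` (`AnticyclotomicTowerSharp`) and CGLS 2022 Thm. 4.1.3
(`CGLSHowardDivisibilityLocalized`): on a rank-one light X9 frame, the coherent pair `(C, F₀)` on `(Dt, H.β)`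
(`exists_coherent_pair_envelope`), the localized package (`package_of_envelopeModules_of_thm413`) and the μ-blind
promotion by rescaling (`PrintX9Rescaling.stub_rescaling`, `F := p^m • F₀`). Kernel-valid AS TYPED; not route
currency (PIN-1 / R0: the `∃ F` is untied). [cite: CastellaGrossiLeeSkinner2022, Thm. 4.1.1, Thm. 4.1.3, Cor. 3.4.2, Rem. 4.1.4]
[cite: Howard2004HeegnerKolyvagin, §1 ("Fixing a modular parametrization"), §3.3, Thm. B] [cite: PerrinRiou1987BSMF, §1 p. 405, §3.4 Prop. 10] -/
theorem howardContainmentLightFrame_of_nonvanishing_of_towerSharp_of_cgls :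
    CGLSHeegnerClassNonvanishing → AnticyclotomicTowerSharp → CGLSHowardDivisibilityLocalized →
      HowardContainmentLightFrame := by
  intro hNV hTw hCGLS W _ _ p _ _ K _ _ hX9 hK hodd h3 hHN hHp hirr κ hκ γ hγ Dt H ιC hrk hfin
  letI : Algebra K ℂ := ιC.toAlgebra
  let jbar : AlgebraicClosure K →+* ℂ :=
    (IsAlgClosed.lift (R := K) (M := ℂ) (S := AlgebraicClosure K)).toRingHom
  have hp : p.Prime := Fact.out
  have hX9' := Summit.BirchSwinnertonDyer.BirchSwinnertonDyer.Rank1Residual.classX9_census_of_classX9 W p hX9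
  have hp_odd : Odd p := hp.odd_of_ne_two hX9'.ne_two
  have hyp := Summit.BirchSwinnertonDyer.Rank1Residual.X9.thm413Hypotheses_of_lightFrame hX9' hK hodd h3 hHN hHp
    hκ hγ
  -- the data `𝔖`, `X`
  obtain ⟨D⟩ := LambdaAdicSelmerDataExists.nonempty_lambdaAdicSelmerData (W.baseChange K) p κ hγ
  obtain ⟨X⟩ := (W.baseChange K).nonempty_selmerDualData_holds κ γ hγ
  -- the coherent pair on `(Dt, H.β)` with its module-level envelope
  obtain ⟨C, F₀, -, -, -, -, hfwd, g, hg, hrev⟩ :=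
    exists_coherent_pair_envelope (W := W) hK hHN Dt H.dvd_sq_sub jbar hyp.ordinary hX9'.not_dvd_conductorNorm κ
      hγ (fun k ↦ hTw K p hp_odd hK κ hκ jbar k)
      (card_ringClassGalOver_prime_one_of_frame hK hodd h3 hp hHp jbar) hyp.noPTorsion D
  have hfwd' : ((p : IwasawaAlgebra p) ^ 0) • heegnerModule D F₀ ≤ stabilizedHeegnerModule D C := by
    rw [pow_zero, one_smul]
    exact hfwd
  -- the localized package from `hNV` and CGLS Thm. 4.1.3 at corank one
  have h411 : thm411_torsionFree_heegnerClass_ne_bot_quotient_isTorsion.{0} := hNV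
  have h413 : thm413_rankOne_charIdeal_torsion_dvd_localized.{0} := hCGLS
  obtain ⟨hSfin, hS1, htorF, hloc⟩ := package_of_envelopeModules_of_thm413 h411 h413 hyp
    (Summit.BirchSwinnertonDyer.Rank1Residual.X9.selmerCorank_eq_one_of_rank_one hrk hfin) D C F₀ X hg hfwd' hrev
  -- the μ-blind promotion by rescaling (landed stub of the v3 line)
  obtain ⟨F, hF⟩ := Summit.BirchSwinnertonDyer.BirchSwinnertonDyer.Theorems.PrintX9Rescaling.stub_rescaling W p K hX9
    hK hodd h3 hHN hHp hirr κ hκ γ hγ jbar D F₀ X hSfin hS1 htorF hloc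
  exact ⟨jbar, D, F, X, hF⟩

/-- **`HowardContainmentLightFrame` from `hNV`, the CGS 2025 Thm. 6.5.2 binder `hCGS` of the live `closes`
(`CGSHowardDivisibilityPLocalized`, ANY Selmer corank) and `hTw♯`** — same composition, the localized package being
`PrintX9SharpMuPart.package_of_envelopeModules` and `Λ`-rank one of `𝔖` read off Thm. 6.5.2.
[cite: CastellaGrossiSkinner2025, Thm. 6.5.2] [cite: CastellaGrossiLeeSkinner2022, Thm. 4.1.1, Rem. 4.1.4] -/
theorem howardContainmentLightFrame_of_nonvanishing_of_cgs_of_towerSharp :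
    CGLSHeegnerClassNonvanishing → CGSHowardDivisibilityPLocalized → AnticyclotomicTowerSharp →
      HowardContainmentLightFrame := by
  intro hNV hCGS hTw W _ _ p _ _ K _ _ hX9 hK hodd h3 hHN hHp hirr κ hκ γ hγ Dt H ιC _hrk _hfin
  letI : Algebra K ℂ := ιC.toAlgebra
  let jbar : AlgebraicClosure K →+* ℂ :=
    (IsAlgClosed.lift (R := K) (M := ℂ) (S := AlgebraicClosure K)).toRingHom
  have hp : p.Prime := Fact.out
  have hX9' := Summit.BirchSwinnertonDyer.BirchSwinnertonDyer.Rank1Residual.classX9_census_of_classX9 W p hX9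
  have hp_odd : Odd p := hp.odd_of_ne_two hX9'.ne_two
  have hyp := Summit.BirchSwinnertonDyer.Rank1Residual.X9.thm413Hypotheses_of_lightFrame hX9' hK hodd h3 hHN hHp
    hκ hγ
  obtain ⟨D⟩ := LambdaAdicSelmerDataExists.nonempty_lambdaAdicSelmerData (W.baseChange K) p κ hγ
  obtain ⟨X⟩ := (W.baseChange K).nonempty_selmerDualData_holds κ γ hγ
  obtain ⟨C, F₀, -, -, -, -, hfwd, g, hg, hrev⟩ :=
    exists_coherent_pair_envelope (W := W) hK hHN Dt H.dvd_sq_sub jbar hyp.ordinary hX9'.not_dvd_conductorNorm κ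
      hγ (fun k ↦ hTw K p hp_odd hK κ hκ jbar k)
      (card_ringClassGalOver_prime_one_of_frame hK hodd h3 hp hHp jbar) hyp.noPTorsion D
  have hfwd' : ((p : IwasawaAlgebra p) ^ 0) • heegnerModule D F₀ ≤ stabilizedHeegnerModule D C := by
    rw [pow_zero, one_smul]
    exact hfwd
  have h411 : thm411_torsionFree_heegnerClass_ne_bot_quotient_isTorsion.{0} := hNV
  have h652 : CastellaGrossiSkinner2025.thm652_stabilized_rankOne_charIdeal_torsion_dvd_pLocalized.{0} := hCGS
  obtain ⟨⟨-, hS1⟩, -⟩ := h652 (W.conductorNorm ℤ) W K p κ γ jbar hyp D C X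
  obtain ⟨hSfin, -, htorF, hloc⟩ :=
    Summit.BirchSwinnertonDyer.BirchSwinnertonDyer.Theorems.PrintX9SharpMuPart.package_of_envelopeModules h411 h652
      hyp D C F₀ X hg hfwd' hrev
  obtain ⟨F, hF⟩ := Summit.BirchSwinnertonDyer.BirchSwinnertonDyer.Theorems.PrintX9Rescaling.stub_rescaling W p K hX9
    hK hodd h3 hHN hHp hirr κ hκ γ hγ jbar D F₀ X hSfin hS1 htorF hloc
  exact ⟨jbar, D, F, X, hF⟩

/-! ## §3 The item `HowardContainmentLightFrameOfPrint` (25235) with its missing binder -/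

/-- **`HowardContainmentLightFrameOfPrint` (stmt-BirchSwinnertonDyer-25235) GRANTED the binder its rev-18 typing
lacks** — CGLS 2022 Thm. 4.1.1 (`CGLSHeegnerClassNonvanishing`) — and the sharp tower (`AnticyclotomicTowerSharp`, the
shape the coherent-pair envelope consumes): of the item's own three binders only `hCGLS` is used (`hMZ`, Mastella–Zerman
Cor. 4.6, and the unsharp tower are idle). The REPAIRED signature of the census («misstated», REF-117 class).
[cite: CastellaGrossiLeeSkinner2022, Thm. 4.1.1, Thm. 4.1.3, Rem. 4.1.4] -/
theorem howardContainmentLightFrameOfPrint_of_nonvanishing_of_towerSharp :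
    CGLSHeegnerClassNonvanishing → AnticyclotomicTowerSharp → HowardContainmentLightFrameOfPrint :=
  fun hNV hTw _hMZ hCGLS _hTw' ↦ howardContainmentLightFrame_of_nonvanishing_of_towerSharp_of_cgls hNV hTw hCGLS

/-! ## §4 The sharp tower discharged (`Literature.NumberTheory.EllipticCurves.anticyclotomicTowerSharp`, p681041) -/

-- The route leaf `AnticyclotomicTowerSharp` (stmt-BirchSwinnertonDyer-27076) has the text of the landed theorem
-- `Literature.NumberTheory.EllipticCurves.anticyclotomicTowerSharp` (x10b-p1-w2, p681041), which is passed BY NAME below;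
-- no alias of type `AnticyclotomicTowerSharp` is declared here (the item's closers belong to its owners).

/-- **`HowardContainmentLightFrame` (24424) from TWO print leaves: CGLS 2022 Thm. 4.1.1 and Thm. 4.1.3** (the tower
being a theorem). [cite: CastellaGrossiLeeSkinner2022, Thm. 4.1.1, Thm. 4.1.3, Cor. 3.4.2, Rem. 4.1.4] -/
theorem howardContainmentLightFrame_of_nonvanishing_of_cgls :
    CGLSHeegnerClassNonvanishing → CGLSHowardDivisibilityLocalized → HowardContainmentLightFrame :=
  fun hNV hCGLS ↦ howardContainmentLightFrame_of_nonvanishing_of_towerSharp_of_cgls hNV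
    Literature.NumberTheory.EllipticCurves.anticyclotomicTowerSharp hCGLS

/-- **`HowardContainmentLightFrame` (24424) from CGLS 2022 Thm. 4.1.1 and CGS 2025 Thm. 6.5.2** (the tower being a
theorem). [cite: CastellaGrossiSkinner2025, Thm. 6.5.2] [cite: CastellaGrossiLeeSkinner2022, Thm. 4.1.1, Rem. 4.1.4] -/
theorem howardContainmentLightFrame_of_nonvanishing_of_cgs :
    CGLSHeegnerClassNonvanishing → CGSHowardDivisibilityPLocalized → HowardContainmentLightFrame :=
  fun hNV hCGS ↦ howardContainmentLightFrame_of_nonvanishing_of_cgs_of_towerSharp hNV hCGS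
    Literature.NumberTheory.EllipticCurves.anticyclotomicTowerSharp

/-- **THE MINIMAL REPAIRED SIGNATURE OF stmt-BirchSwinnertonDyer-25235**:
`CGLSHeegnerClassNonvanishing → HowardContainmentLightFrameOfPrint` — the item granted the ONE binder its rev-18
typing lacks (CGLS 2022 Thm. 4.1.1: a non-torsion `Λ`-adic Heegner class, Cornut–Vatsal). Of the item's own binders
only `hCGLS` is used. A planner restating 25235 with this text closes it by this theorem at once; as filed it stays
open (census: not closable by name — `Module.charIdeal` is `⊤` off the torsion locus).
[cite: CastellaGrossiLeeSkinner2022, Thm. 4.1.1, Thm. 4.1.3, Rem. 4.1.4] [cite: Cornut2002, Thm. (Mazur's conjecture)] -/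
theorem howardContainmentLightFrameOfPrint_of_nonvanishing :
    CGLSHeegnerClassNonvanishing → HowardContainmentLightFrameOfPrint :=
  fun hNV _hMZ hCGLS _hTw ↦ howardContainmentLightFrame_of_nonvanishing_of_cgls hNV hCGLS

end Summit.BirchSwinnertonDyer.BirchSwinnertonDyer.Theorems.PrintX9OfPrintNonvanishing

end
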